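import Summits.CriticalPhenomena.PercolationContinuityZ3.Theorems.PercNearOneGluingNoHeavyLowerTailFKHullPortTASRigid
import Summits.CriticalPhenomena.PercolationContinuityZ3.Theorems.PercNearOneGluingNoHeavyLowerTailFKHullPortDeltaNS
import Summits.CriticalPhenomena.PercolationContinuityZ3.Theorems.PercNearOneGluingNoHeavyLowerTailHullPortTASPrelim
import HarnessLib

/-!
# FK sub-lane: Lemma `Δ_N^S` for `φ_{𝐩,q}` from (★^H) at singletons — the single-pair case

Support file (`--supports stmt-CriticalPhenomena-4575`), FK sub-lane `prim-bschramm-fk-2` (gen 3); builds on p205010 (kernel theorem,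
internal audit signed; external expert review pending).  No definitions, no named facts, no sorries; standard axioms.

The owner-set copy of `…FKHullPortDeltaNBase.lean` (this cell; bschramm/FK-Q2.md §12.6(c) CASE B): if `e = s(a,b)` is the only
fractional pair touching the avoided set `X`, then for an internal `e` both states are rigid and `Δ^S = 0`, and for an exit `e` the
contraction is `q⁻¹ ×` the deleted state with `b` avoided (constant tilt, `FK.sum_update_one_eq_tilt`), vdBHK Lemma 2.3 turns everything
into world quantities of `H = G − B_X`, and the inequality is hp-8's (★^H) for `φ_{𝐩,q}` in `H` with `N = {b}`, in `P_v` shape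
(`hStarS`).  Together with `FK.deltaNS_nonneg_of_single`: `FK.deltaNS_nonneg_of_starS`.
[cite: VandenbergHaggstromKahn2005, §2.1 Lemma 2.3 (p. 10); Thm. 1.4 (p. 7)] [cite: Gladkov2024, Thm. 3.2 (p. 4)]
[cite: Grimmett2006, Thm. (3.1)(a), eq. (1.20)]
-/

noncomputable section

namespace Summit.CriticalPhenomena.PercolationContinuityZ3.Theorems.FK

open MeasureTheory Set Literature.Probability.LatticeModels Literature.Probability.Percolation
open Literature.Probability.Percolation.DecisionTree (ind ind_of_mem ind_of_not_mem ind_nonneg)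
open Literature.Probability.Percolation.BHK2006 (rcMass delW)
open Summit.CriticalPhenomena.PercolationContinuityZ3.Theorems.HullPort (cut avoidEv connS)
open scoped Classical

variable {V : Type*} [Fintype V]

section SinglePairS

open Literature.Probability.Percolation.BHK2006 (weight rcMass_nonneg coe_delW setCl barOf mem_setCl_iff mem_barOf_iff
  rc_sum_setCl_eq sum_rcMass)
open Summit.CriticalPhenomena.PercolationContinuityZ3.Theorems.HullPort (insert_mem_avoidEv_iff cut_insert_edge edge_mem_cut
  eq_of_reachable_of_isolated mem_cut_of_mem cut_insert_vertex cut_empty mem_of_reachable_of_noBoundary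
  not_mem_of_reachable_of_noBoundary cut_eq_of_noBoundary reachable_sdiff_iff_of_noBoundary sum_weight_resample
  avoidEv_union_insert_eq ind_inter_compl)

/-! ### The single-pair case -/

/-- **The single-fractional-pair case of Lemma `Δ_N^S` for `φ_{𝐩,q}`** (hypothesis `hBase` of `FK.deltaNS_nonneg_of_single`) from
hp-8's (★^H) at singletons for `φ_{𝐩,q}` in every weighted graph, in `P_v` shape (hypothesis `hStarS`; the owner-set copy of
`FK.deltaN_single_of_Pv`):
if `e = s(a,b)` is the only fractional pair touching `X`, then for an internal `e` both states are rigid and `Δ = 0`, and for an exit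
`e` the contraction is `q⁻¹ ×` the state `(w[e↦0], X ∪ {b})` (constant tilt), the Markov factorisation (vdBHK Lemma 2.3) turns
everything into world quantities of `H = G − B_X`, and the inequality is exactly (★^H) in `H` with `N = {b}` (bschramm/FK-Q2.md §12.6(c) CASE B).
[cite: VandenbergHaggstromKahn2005, §2.1 Lemma 2.3 (p. 10); Thm. 1.3 (p. 6)] [cite: Gladkov2024, Thm. 3.2 (p. 4)]
[cite: Grimmett2006, Thm. (3.1)(a), eq. (1.20)] -/
theorem deltaNS_single_of_starS {q : ℝ} (hq : 1 ≤ q) (x : V) (S : Set V) (y : V) (hyS : y ∉ S) (g : Set (Sym2 V) → ℝ)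
    (hStarS : ∀ (u : Sym2 V → unitInterval) (v' : V),
      taBS u q x S y {v'} g ≤ rcPartitionFunctionW u q ∅ *
        ((1 - wE u q ∅ (ind ((connS S y : Set (Set (Sym2 V)))ᶜ ∩ openConn y v')) /
              wE u q ∅ (ind (connS S y : Set (Set (Sym2 V)))ᶜ)) *
          (wE u q ∅ (fun η => g (openEdgeCluster η x) * ind (connS S y) η) -
            wE u q ∅ (fun η => g (openEdgeCluster η x)) * wE u q ∅ (ind (connS S y)))))
    (w : Sym2 V → unitInterval) (X : Set V) (hINV : ∀ p : Sym2 V, ((w p : unitInterval) : ℝ) = 1 → ∀ u ∈ p, u ∈ X)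
    (hsX : x ∉ X) (hyX : y ∉ X) (a b : V) (ha : a ∈ X) (hab : a ≠ b) (hbs : b ≠ x) (hby : b ≠ y)
    (h0 : 0 < ((w s(a, b) : unitInterval) : ℝ)) (h1 : ((w s(a, b) : unitInterval) : ℝ) < 1)
    (hrig : ∀ p : Sym2 V, ¬ p.IsDiag → (∃ c ∈ p, c ∈ X) → p ≠ s(a, b) →
      ((w p : unitInterval) : ℝ) = 0 ∨ ((w p : unitInterval) : ℝ) = 1) :
    0 ≤ taBS (Function.update w s(a, b) 0) q x S y X g * tabS (Function.update w s(a, b) 1) q S y (insert b X) -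
        taBS (Function.update w s(a, b) 1) q x S y (insert b X) g * tabS (Function.update w s(a, b) 0) q S y X := by
  classical
  have hq0 : 0 < q := one_pos.trans_le hq
  set e : Sym2 V := s(a, b) with he
  set w₀ := Function.update w e 0 with hw₀
  set w₁ := Function.update w e 1 with hw₁
  -- rigidity and invariants of the deleted state
  have hR0 : ∀ p : Sym2 V, ¬ p.IsDiag → (∃ u ∈ p, u ∈ X) →
      ((w₀ p : unitInterval) : ℝ) = 0 ∨ ((w₀ p : unitInterval) : ℝ) = 1 := by
    intro p hd hp
    by_cases hpe : p = e
    · left; rw [hpe]; simp [hw₀]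
    · rw [show w₀ p = w p from Function.update_of_ne hpe _ _]; exact hrig p hd hp hpe
  have hI0 : ∀ p : Sym2 V, ((w₀ p : unitInterval) : ℝ) = 1 → ∀ u ∈ p, u ∈ X := by
    intro p hp u hu
    by_cases hpe : p = e
    · rw [hpe] at hp; simp [hw₀] at hp
    · rw [show w₀ p = w p from Function.update_of_ne hpe _ _] at hp; exact hINV p hp u hu
  by_cases hbX : b ∈ X
  · -- INTERNAL pair: both states are rigid, `Δ = 0`
    have hXb : insert b X = X := Set.insert_eq_of_mem hbX
    have hR1 : ∀ p : Sym2 V, ¬ p.IsDiag → (∃ u ∈ p, u ∈ X) →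
        ((w₁ p : unitInterval) : ℝ) = 0 ∨ ((w₁ p : unitInterval) : ℝ) = 1 := by
      intro p hd hp
      by_cases hpe : p = e
      · right; rw [hpe]; simp [hw₁]
      · rw [show w₁ p = w p from Function.update_of_ne hpe _ _]; exact hrig p hd hp hpe
    have hI1 : ∀ p : Sym2 V, ((w₁ p : unitInterval) : ℝ) = 1 → ∀ u ∈ p, u ∈ X := by
      intro p hp u hu
      by_cases hpe : p = e
      · rw [hpe, he] at hu
        rcases Sym2.mem_iff.1 hu with rfl | rfl
        · exact ha
        · exact hbX
      · rw [show w₁ p = w p from Function.update_of_ne hpe _ _] at hp; exact hINV p hp u hu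
    rw [hXb, taBS_rigid w₀ q S y hsX hR0 hI0 g, taBS_rigid w₁ q S y hsX hR1 hI1 g, tabS_rigid w₀ hq0 S hyX hR0 hI0,
      tabS_rigid w₁ hq0 S hyX hR1 hI1]
    set B : Set (Sym2 V) := {p : Sym2 V | ∃ u ∈ p, u ∈ X} with hB
    have heB : e ∈ B := ⟨a, by rw [he]; exact Sym2.mem_mk_left _ _, ha⟩
    have hwB : ∀ p ∉ B, w₀ p = w₁ p := by
      intro p hp
      have hpe : p ≠ e := fun h => hp (h ▸ heB)
      rw [show w₀ p = w p from Function.update_of_ne hpe _ _, show w₁ p = w p from Function.update_of_ne hpe _ _]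
    simp only [wE_congr_off q hwB]
    have : rcPartitionFunctionW w₀ q ∅ *
          (wE w₁ q B (fun η => g (openEdgeCluster η x) * ind (connS S y) η) -
            wE w₁ q B (fun η => g (openEdgeCluster η x)) * wE w₁ q B (ind (connS S y))) *
          (rcPartitionFunctionW w₁ q ∅ * wE w₁ q B (ind (connS S y : Set (Set (Sym2 V)))ᶜ)) -
        rcPartitionFunctionW w₁ q ∅ *
          (wE w₁ q B (fun η => g (openEdgeCluster η x) * ind (connS S y) η) -
            wE w₁ q B (fun η => g (openEdgeCluster η x)) * wE w₁ q B (ind (connS S y))) *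
          (rcPartitionFunctionW w₀ q ∅ * wE w₁ q B (ind (connS S y : Set (Set (Sym2 V)))ᶜ)) = 0 := by ring
    rw [this]
  · -- EXIT pair
    have hXb' : a ∈ insert b X := Set.mem_insert_of_mem _ ha
    -- constant tilt for `B` and `b`
    have tiltB : taBS w₁ q x S y (insert b X) g = q⁻¹ * taBS w₀ q x S y (insert b X) g := by
      unfold taBS
      rw [sum_update_one_eq_tilt w hq0 ha hbX hrig hINV (fun ω => ind (avoidEv x (insert b X)) ω * taCS w₁ q x S y (insert b X) g ω)]
      congr 1
      refine Finset.sum_congr rfl fun ω _ => ?_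
      have hav : ind (avoidEv x (insert b X)) (insert e ω) = ind (avoidEv x (insert b X)) ω := by
        have hiff := insert_mem_avoidEv_iff x a b (insert b X) hXb' ω
        rw [Set.insert_eq_of_mem (Set.mem_insert b X)] at hiff
        by_cases h : ω ∈ avoidEv x (insert b X)
        · rw [ind_of_mem h, ind_of_mem (hiff.2 h)]
        · rw [ind_of_not_mem h, ind_of_not_mem (fun h' => h (hiff.1 h'))]
      have hC : taCS w₁ q x S y (insert b X) g (insert e ω) = taCS w₀ q x S y (insert b X) g ω := by
        have hcut : cut (insert b X) (insert e ω) = cut (insert b X) ω := by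
          rw [he, cut_insert_edge a b (insert b X) hXb' ω, Set.insert_eq_of_mem (Set.mem_insert b X)]
        unfold taCS
        rw [hcut, wE_congr_off q (update_eq_off_cut w₁ a b (insert b X) hXb' 0 ω),
          wE_congr_off q (update_eq_off_cut w₁ a b (insert b X) hXb' 0 ω),
          wE_congr_off q (update_eq_off_cut w₁ a b (insert b X) hXb' 0 ω)]
        have : Function.update w₁ s(a, b) 0 = w₀ := by
          rw [hw₁, hw₀, ← he, Function.update_idem]
        rw [this]
      show rcWeightW w₀ q ∅ ω * (ind (avoidEv x (insert b X)) (insert e ω) * taCS w₁ q x S y (insert b X) g (insert e ω)) =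
        rcWeightW w₀ q ∅ ω * (ind (avoidEv x (insert b X)) ω * taCS w₀ q x S y (insert b X) g ω)
      rw [hav, hC]
    have tiltb : tabS w₁ q S y (insert b X) = q⁻¹ * tabS w₀ q S y (insert b X) := by
      unfold tabS
      rw [sum_update_one_eq_tilt w hq0 ha hbX hrig hINV (fun ω => ind (avoidEv y (S ∪ insert b X)) ω)]
      congr 1
      refine Finset.sum_congr rfl fun ω _ => ?_
      have hXb'' : a ∈ S ∪ insert b X := Set.mem_union_right _ hXb'
      have hiff := insert_mem_avoidEv_iff y a b (S ∪ insert b X) hXb'' ω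
      rw [Set.insert_eq_of_mem (Set.mem_union_right S (Set.mem_insert b X))] at hiff
      show rcWeightW w₀ q ∅ ω * ind (avoidEv y (S ∪ insert b X)) (insert e ω) =
        rcWeightW w₀ q ∅ ω * ind (avoidEv y (S ∪ insert b X)) ω
      by_cases h : ω ∈ avoidEv y (S ∪ insert b X)
      · rw [ind_of_mem h, ind_of_mem (hiff.2 h)]
      · rw [ind_of_not_mem h, ind_of_not_mem (fun h' => h (hiff.1 h'))]
    -- `b(w₀, X ∪ {b}) = b(w₀, X) − a(w₀; b; X)`
    have tabins : tabS w₀ q S y (insert b X) = tabS w₀ q S y X - taaS w₀ q S y b X := by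
      unfold tabS taaS
      rw [← Finset.sum_sub_distrib]
      refine Finset.sum_congr rfl fun ω _ => ?_
      rw [avoidEv_union_insert_eq S y b X, ind_inter_compl]
      have : ind (avoidEv y (S ∪ X) ∩ openConn y b) ω = ind (avoidEv y (S ∪ X)) ω * ind (openConn y b) ω := by
        by_cases h1 : ω ∈ avoidEv y (S ∪ X) <;> by_cases h2 : ω ∈ openConn y b
        · rw [ind_of_mem (Set.mem_inter h1 h2), ind_of_mem h1, ind_of_mem h2, mul_one]
        · rw [ind_of_not_mem (fun h => h2 h.2), ind_of_mem h1, ind_of_not_mem h2, mul_zero]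
        · rw [ind_of_not_mem (fun h => h1 h.1), ind_of_not_mem h1, zero_mul]
        · rw [ind_of_not_mem (fun h => h1 h.1), ind_of_not_mem h1, zero_mul]
      rw [this]; ring
    rw [tiltB, tiltb, tabins]
    rw [taBS_rigid w₀ q S y hsX hR0 hI0 g, tabS_rigid w₀ hq0 S hyX hR0 hI0, taaS_rigid w₀ hq0 S hyX hR0 hI0,
      taBS_insert_rigid w₀ hq0 S y hsX hbX hR0 hI0 g]
    -- world quantities of `H = G − B_X`
    set B : Set (Sym2 V) := {p : Sym2 V | ∃ u ∈ p, u ∈ X} with hB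
    set wH := delW w₀ B with hwH
    set c : ℝ := wE w₀ q B (fun η => g (openEdgeCluster η x) * ind (connS S y) η) -
      wE w₀ q B (fun η => g (openEdgeCluster η x)) * wE w₀ q B (ind (connS S y)) with hc
    set n : ℝ := wE w₀ q B (ind (connS S y : Set (Set (Sym2 V)))ᶜ) with hn
    set nb : ℝ := wE w₀ q B (ind ((connS S y : Set (Set (Sym2 V)))ᶜ ∩ openConn y b)) with hnb
    set β : ℝ := wE w₀ q B (fun η => ind (avoidEv x {b}) η * taCS wH q x S y {b} g η) with hβ
    set Z₀ : ℝ := rcPartitionFunctionW w₀ q ∅ with hZ₀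
    -- (★^H) in the world `H`, at `N = {b}`
    have hZH := rcPartitionFunctionW_pos wH hq0 ∅
    have hwHE : ∀ φ : Set (Sym2 V) → ℝ, wE wH q ∅ φ = wE w₀ q B φ := fun φ => wE_delW_empty w₀ q B φ
    have hBH : taBS wH q x S y {b} g = rcPartitionFunctionW wH q ∅ * β := by
      rw [hβ, ← hwHE]
      unfold taBS wE
      rw [Finset.mul_sum]
      refine Finset.sum_congr rfl fun η _ => ?_
      rw [delW_empty]
      unfold rcMass
      field_simp
    have hPvH := hStarS wH b
    rw [hBH, hwHE, hwHE, hwHE, hwHE, hwHE] at hPvH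
    -- `n > 0` (no weight-1 pair in the world weights)
    have hn0 : 0 < n := by
      rw [hn, ← hwHE]
      refine wE_compl_connS_pos wH hq0 hyS fun p hp1 => ?_
      by_cases hpB : p ∈ B
      · rw [hwH, coe_delW, if_pos hpB] at hp1; exact zero_ne_one hp1
      · rw [hwH, coe_delW, if_neg hpB] at hp1
        apply hpB
        induction p using Sym2.ind with
        | h u' v' => exact ⟨u', Sym2.mem_mk_left _ _, hI0 _ hp1 u' (Sym2.mem_mk_left _ _)⟩
    have hβle : β * n ≤ (n - nb) * c := by
      have h1' : β ≤ (1 - nb / n) * c := le_of_mul_le_mul_left (by linarith [hPvH]) hZH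
      have h2' : (1 - nb / n) * c * n = (n - nb) * c := by field_simp
      nlinarith [mul_le_mul_of_nonneg_right h1' hn0.le]
    have hqinv : 0 < q⁻¹ := inv_pos.2 hq0
    have hZ0 : 0 < Z₀ := rcPartitionFunctionW_pos w₀ hq0 ∅
    have key : Z₀ * c * (q⁻¹ * (Z₀ * n - Z₀ * nb)) - q⁻¹ * (Z₀ * β) * (Z₀ * n) =
        q⁻¹ * Z₀ ^ 2 * ((n - nb) * c - β * n) := by ring
    rw [key]
    exact mul_nonneg (mul_nonneg hqinv.le (sq_nonneg _)) (by linarith)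

/-- **Lemma `Δ_N^S` for the random-cluster measure `φ_{𝐩,q}`, `q ≥ 1`, from (★^H) at singletons** (owner-set copy of
`FK.deltaN_nonneg_of_Pv`; bschramm/FK-Q2.md §12.6(c)): for every weight vector `w` with weight-`1` pairs inside the avoided set `X`,
every monotone `g`, and every fractional pair `e = s(a,b)` touching `X`,
`B^S(w[e↦1], X∪{b})·b^S(w[e↦0], X) ≤ B^S(w[e↦0], X)·b^S(w[e↦1], X∪{b})`.
[cite: VandenbergHaggstromKahn2005, Thm. 2.1 (p. 9); §2.1 Lemma 2.3 (p. 10)] [cite: Gladkov2024, Thm. 3.2 (p. 4)] [cite: Grimmett2006, Thm. (3.1)(a), Thm. (3.8)(b)] -/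
theorem deltaNS_nonneg_of_starS {q : ℝ} (hq : 1 ≤ q) (x : V) (S : Set V) (y : V) (hyS : y ∉ S) (g : Set (Sym2 V) → ℝ)
    (hg : Monotone g)
    (hStarS : ∀ (u : Sym2 V → unitInterval) (v' : V),
      taBS u q x S y {v'} g ≤ rcPartitionFunctionW u q ∅ *
        ((1 - wE u q ∅ (ind ((connS S y : Set (Set (Sym2 V)))ᶜ ∩ openConn y v')) /
              wE u q ∅ (ind (connS S y : Set (Set (Sym2 V)))ᶜ)) *
          (wE u q ∅ (fun η => g (openEdgeCluster η x) * ind (connS S y) η) -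
            wE u q ∅ (fun η => g (openEdgeCluster η x)) * wE u q ∅ (ind (connS S y)))))
    (w : Sym2 V → unitInterval) (X : Set V) (hINV : ∀ p : Sym2 V, ((w p : unitInterval) : ℝ) = 1 → ∀ u ∈ p, u ∈ X)
    {a b : V} (ha : a ∈ X) (hab : a ≠ b) (h0 : 0 < ((w s(a, b) : unitInterval) : ℝ))
    (h1 : ((w s(a, b) : unitInterval) : ℝ) < 1) :
    0 ≤ taBS (Function.update w s(a, b) 0) q x S y X g * tabS (Function.update w s(a, b) 1) q S y (insert b X) -
        taBS (Function.update w s(a, b) 1) q x S y (insert b X) g * tabS (Function.update w s(a, b) 0) q S y X :=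
  deltaNS_nonneg_of_single hq x S y hyS g hg
    (fun w X hI hsX hyX a b ha hab hbs hby h0 h1 hrig =>
      deltaNS_single_of_starS hq x S y hyS g hStarS w X hI hsX hyX a b ha hab hbs hby h0 h1 hrig)
    w X hINV ha hab h0 h1

end SinglePairS

end Summit.CriticalPhenomena.PercolationContinuityZ3.Theorems.FK

end
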